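/-
Copyright (c) 2026 the pub-hodgecm-mathlib formalisation cell (harness21).  Prover seat hodgecm-mathlib-F0P2-p10 (g0) (strike line L1, LEAD F0P6-plan (g14)),
Track B «K2-LIT», #184♮ = hLiu418 = `stmt-HodgeConjecture-24832`; Road I v3, S5-F3 lineage ∕ I4-conv (F′-fact): the `cΔ` ∕ `hfU` dischargers of the local
Borel law of the Klingen-fibre inner section (beneath F0P2-p09's `innerSectionLoc_upper_mul`) and the assembly into ★ C's `hlaw`.
-/
import Summits.HodgeConjecture.HodgeConjecture.Theorems.K2LiuKlingenInnerSectionLocalDefs   -- ★ FILE B: `jLoc`, `coe_jLoc_apply`, `coe_jLoc_symm_apply`, the local letters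
import Summits.HodgeConjecture.HodgeConjecture.Theorems.K2LiuKlingenInnerSectionLeviLaw     -- ★ F5-c §0–§1: generic-ring `ξ m_Q(a,b) ξ⁻¹` matrix, block shape, `det` (+ ★ `reindex_symm_mul_mul`)
import Literature.NumberTheory.K2Lit.LocalDoublingSiegel                                   -- ★ D7c: `siegelDeltaLoc`, `siegelCharLoc`, `LambdaLoc`, `lambdaLoc_siegel_mul` (+ ★ D1 `localSiegelCharacter`)
import HarnessLib

/-!
# Crux `HLiu418`, I4-conv (F′-fact) — `K2LiuKlingenInnerSectionLocalCharacter`: THE INDUCING CHARACTER OF THE LOCAL KLINGEN–LEVI LAW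
# `cΔ(b) = siegelCharLoc χ v s (Ψ_v(ξ_v m_{Q,v}(1,b) ξ_v⁻¹)) = ∏_{w∣v} χ_w(b_w,₀₀) · (∏_{w∣v} ‖b_w,₀₀‖_w)^{s+1}`, `Ψ_v(ξ u₊ ξ⁻¹)` IS INVISIBLE, and the assembly into ★ C's `hlaw`

Cell `hodgecm-mathlib`, crux item hLiu418 = `stmt-HodgeConjecture-24832`; squad K2 ∕ K2Liu; LEAD F0P6-plan (g14); K2Liu-p14 (g3)'s organ U1 (I4-conv): FILE B ★
`K2LiuKlingenInnerSectionLocalDefs` (letters), F0P2-p09 (g0)'s `K2LiuKlingenInnerSectionLocalLaw` (`innerSectionLoc_upper_mul`, hypothesis-first: `hfP`∕`hfU`∕`hνT`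
with `cΔ`, `mT` BY VALUE), ★ C `K2LiuKlingenInnerSectionSpherical` (F0P2-p10: `hlaw`∕`hK` BY VALUE).  THIS FILE discharges `hfP`, `hfU` for the unramified Siegel section
`f_v := Λ_{s,v}` (★ D7c `LambdaLoc`) of the doubled group `H = U(𝕍 ⊕ −𝕍)(L⁺_v)` (`n = 2`), for ANY local transport `Ψ_v : U(J₄)(L⁺_v) →* H(L⁺_v)` whose `w`-components are
conjugation by a frame `S_w = (1 X_w; 1 −X_w)`, `S_w⁻¹ = (a_w a_w; Y_w −Y_w)`, `a_w + a_w = 1` (BY VALUE: `hΨv`, `hSAw`, `hSAwi`, `haw` — the place-`w` readings of the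
F-files' pins `hΨ`, `hSA`, `hSAi`, `ha`; FILE B∕B2's `psiLoc Ψ v` is such a `Ψ_v`), and COMPUTES `cΔ`; then assembles p09's head + the two values into ★ C's `hlaw`
VERBATIM at `σ = s − ½`.  THEOREMS ONLY (no `def`, no instance, no notation, no named-fact hypothesis, no `sorry`); lane `--supports stmt-HodgeConjecture-24832 --as helper`.
* §1 (generic commutative ring, generic `n`) **`isSiegelM_conj_of_frame`**, **`detDeltaM_conj_of_frame`** — for block-upper-triangular `Z` and a frame `(S, S⁻¹, a)` as
  above, `S Z S⁻¹ ∈ P_Δ` (★ `IsSiegelM`) and `det_Δ(S Z S⁻¹) = det Z₁₁` — the RING-GENERIC form of ★ F3′ `K2LiuDoubledAntidiagonalTransportLevi.deltaBlock_transport`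
  (there over `𝔸_L` with the membership taken from the pin (T4); here both from the block algebra `(1 X;1 −X)(Z₁₁ Z₁₂;0 Z₂₂)(a a;Y −Y)`: row sums `(a+a)Z₁₁ = Z₁₁`).
* §2 (the place `v`; frame BY VALUE) `coe_psiv_jLoc` (the `w`-matrix of `Ψ_v(j_v g)` is `S_w · g_w · S_w⁻¹`), **`psiv_weylXi_conj_klingenLevi_mem_siegelDeltaLoc`** +
  **`localDetDelta_psiv_weylXi_conj_klingenLevi`** (`Ψ_v(ξ m(1,b) ξ⁻¹) ∈ P_Δ(L⁺_v)`, `det_Δ,w = (b_w)₀₀`; ★ F5-c `coe_weylXi_conj_klingenLevi_of_upper` ∕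
  `det_toBlocks₁₁_weylXi_conj_klingenLevi_of_upper` at `R := L_v = Π_w L_w`, `a := 1`), **`siegelCharLoc_psiv_weylXi_conj_klingenLevi`** (THE VALUE
  `∏_w χ_w(u_w) · (∏_w ‖u_w‖_w)^{s+1}`, `u_w = (b_w)₀₀`; ★ D7c `siegelCharLoc_eq_localSiegelCharacter_of_mem`, ★ D1 at `n = 2`), `psiv_weylXi_conj_uPlus_mem_siegelDeltaLoc` +
  **`siegelCharLoc_psiv_weylXi_conj_uPlus`** (`ξ u₊(t) ξ⁻¹ = u₋(−σt)` ★, block-unipotent ⇒ character `1`).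
* §3 THE DISCHARGERS in p09's shapes: **`lambdaLoc_psiv_levi_mul`** (`hfP` for `f_v = Λ_{s,v}` with `cΔ b := siegelCharLoc … (Ψ_v(ξ m(1,b) ξ⁻¹))`, ★ `lambdaLoc_siegel_mul`),
  **`lambdaLoc_psiv_uPlus_mul`** (`hfU`).
* §4 THE ASSEMBLY **`hlaw_of_upper_mul`**: p09's head BY VALUE (`hJ : J(b g) = cΔ b · (mT u).toReal · J g`) + §2's value of `cΔ` + `(mT u).toReal = (∏_w ‖u_w‖)⁻¹` BY VALUE
  (the modulus file) ⇒ ★ C's binder `hlaw` VERBATIM at the parameter `σ := s − ½` (`(∏‖u‖)^{s+1} · (∏‖u‖)⁻¹ = (∏‖u‖)^{(s−½)+½}`).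
[Xiong2013, §4 Prop. 4.1, §7 Lemma 7.1], [GanTakeda2011SiegelWeil, §7.2 p. 23], [HarrisKudlaSweet1996, §1 (1.11)–(1.15)], [Kudla1994, §3], [MoeglinWaldspurger1995, II.1.7],
[Tan1999, §1–§2].  HONEST LABEL.  Count-neutral helper: `HC_CM` is proved only modulo the 7 printed citations (2 remaining named inputs: hLiu418 =
`stmt-HodgeConjecture-24832`, h413 = `stmt-HodgeConjecture-24833`) until rung 0 closes.
-/

set_option autoImplicit false
set_option linter.dupNamespace false -- the mandated namespace repeats `HodgeConjecture.HodgeConjecture`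

noncomputable section

open scoped Matrix
open NumberField IsDedekindDomain
open Literature.NumberTheory.Automorphic Literature.NumberTheory.Automorphic.UnitaryGroup
open Literature.NumberTheory.GaloisRepresentations
open Literature.NumberTheory.GelbartRogawski1991 Literature.NumberTheory.GelbartRogawski1991.GRConstruction
open Literature.NumberTheory.GelbartRogawski1991.UnitaryDualPair
open Literature.NumberTheory.K2Lit.SiegelDoubled Literature.NumberTheory.K2Lit.LocalSiegelDoubled
open Summit.HodgeConjecture.HodgeConjecture.Cruxes.HLiu418.K2LiuKlingenParabolicDefs
open Summit.HodgeConjecture.HodgeConjecture.Cruxes.HLiu418.K2LiuDoubledUTwoTwoBorelFrame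
open Summit.HodgeConjecture.HodgeConjecture.Cruxes.HLiu418.K2LiuKlingenInnerSectionLocalDefs
open Summit.HodgeConjecture.HodgeConjecture.Cruxes.HLiu418.K2LiuKlingenInnerSectionLeviLaw
  (coe_weylXi_conj_klingenLevi_of_upper blockTriangular_weylXi_conj_klingenLevi_of_upper det_toBlocks₁₁_weylXi_conj_klingenLevi_of_upper
    det_toBlocks₁₁_uMinusM uMinusM_blockTriangular)
open Summit.HodgeConjecture.HodgeConjecture.Cruxes.HLiu418.K2LiuKlingenUnipotentDefs (weylXi_mul_uPlus_mul_inv)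
open Summit.HodgeConjecture.HodgeConjecture.Cruxes.HLiu418.K2LiuSiegelDoubledIwasawaCompact (reindex_symm_mul_mul toBlocks₂₁_reindex_eq_zero_of_blockTriangular)

namespace Summit.HodgeConjecture.HodgeConjecture.Cruxes.HLiu418.K2LiuKlingenInnerSectionLocalCharacter

/-! ## §1 Generic ring: a frame conjugate of a block-upper-triangular matrix lies in `P_Δ` with `det_Δ = det Z₁₁` -/

section Generic

variable {R : Type*} [CommRing R] {n : ℕ}

/-- the two `Δ`-row sums of `S Z S⁻¹` for the frame `S = (1 X; 1 −X)`, `S⁻¹ = (a a; Y −Y)`, `a + a = 1` and block-upper-triangular `Z`: both equal `Z₁₁`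
(the `Y`-columns cancel; ring-generic form of ★ F3′ `deltaBlock_transport`). [cite: HarrisKudlaSweet1996, §1 (1.11)–(1.12)] -/
theorem rowBlocks_conj_of_frame (S Si Z : Matrix (Fin (n + n)) (Fin (n + n)) R) (X Y : Matrix (Fin n) (Fin n) R) (a : R) (ha : a + a = 1)
    (hS : Matrix.reindex (e₂ (n := n)).symm (e₂ (n := n)).symm S = Matrix.fromBlocks 1 X 1 (-X))
    (hSi : Matrix.reindex (e₂ (n := n)).symm (e₂ (n := n)).symm Si = Matrix.fromBlocks (a • (1 : Matrix (Fin n) (Fin n) R)) (a • 1) Y (-Y))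
    (hZ : Z.BlockTriangular id) :
    (Matrix.reindex (e₂ (n := n)).symm (e₂ (n := n)).symm (S * Z * Si)).toBlocks₁₁ + (Matrix.reindex (e₂ (n := n)).symm (e₂ (n := n)).symm (S * Z * Si)).toBlocks₁₂ =
        (Matrix.reindex (e₂ (n := n)).symm (e₂ (n := n)).symm Z).toBlocks₁₁ ∧
      (Matrix.reindex (e₂ (n := n)).symm (e₂ (n := n)).symm (S * Z * Si)).toBlocks₂₁ + (Matrix.reindex (e₂ (n := n)).symm (e₂ (n := n)).symm (S * Z * Si)).toBlocks₂₂ =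
        (Matrix.reindex (e₂ (n := n)).symm (e₂ (n := n)).symm Z).toBlocks₁₁ := by
  have h21 := toBlocks₂₁_reindex_eq_zero_of_blockTriangular hZ
  have hBeq : Matrix.reindex (e₂ (n := n)).symm (e₂ (n := n)).symm Z =
      Matrix.fromBlocks (Matrix.reindex (e₂ (n := n)).symm (e₂ (n := n)).symm Z).toBlocks₁₁ (Matrix.reindex (e₂ (n := n)).symm (e₂ (n := n)).symm Z).toBlocks₁₂
        0 (Matrix.reindex (e₂ (n := n)).symm (e₂ (n := n)).symm Z).toBlocks₂₂ := by
    conv_lhs => rw [← Matrix.fromBlocks_toBlocks (Matrix.reindex (e₂ (n := n)).symm (e₂ (n := n)).symm Z)]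
    rw [h21]
  have hsum : ∀ P Q : Matrix (Fin n) (Fin n) R, a • P + Q + (a • P + -Q) = P := fun P Q => by
    rw [show a • P + Q + (a • P + -Q) = a • P + a • P by abel, ← add_smul, ha, one_smul]
  rw [reindex_symm_mul_mul, hS, hSi]
  -- expand the middle factor into its blocks (lower-left block `0`), multiply out
  generalize hB : Matrix.reindex (e₂ (n := n)).symm (e₂ (n := n)).symm Z = B at hBeq ⊢
  rw [hBeq, Matrix.fromBlocks_multiply, Matrix.fromBlocks_multiply]
  simp only [Matrix.toBlocks_fromBlocks₁₁, Matrix.toBlocks_fromBlocks₁₂, Matrix.toBlocks_fromBlocks₂₁, Matrix.toBlocks_fromBlocks₂₂,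
    Matrix.one_mul, Matrix.mul_zero, add_zero, Matrix.mul_smul, Matrix.mul_one, Matrix.mul_neg, Matrix.neg_mul]
  exact ⟨hsum _ _, hsum _ _⟩

/-- **`S Z S⁻¹ ∈ P_Δ`** (★ `IsSiegelM`: the two `Δ`-row sums agree) for block-upper-triangular `Z` and a frame as above. [cite: HarrisKudlaSweet1996, §1 (1.11)] -/
theorem isSiegelM_conj_of_frame (S Si Z : Matrix (Fin (n + n)) (Fin (n + n)) R) (X Y : Matrix (Fin n) (Fin n) R) (a : R) (ha : a + a = 1)
    (hS : Matrix.reindex (e₂ (n := n)).symm (e₂ (n := n)).symm S = Matrix.fromBlocks 1 X 1 (-X))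
    (hSi : Matrix.reindex (e₂ (n := n)).symm (e₂ (n := n)).symm Si = Matrix.fromBlocks (a • (1 : Matrix (Fin n) (Fin n) R)) (a • 1) Y (-Y))
    (hZ : Z.BlockTriangular id) : IsSiegelM (S * Z * Si) := by
  obtain ⟨h1, h2⟩ := rowBlocks_conj_of_frame S Si Z X Y a ha hS hSi hZ
  unfold IsSiegelM
  rw [h1, h2]

/-- **`det_Δ(S Z S⁻¹) = det Z₁₁`** (★ `detDeltaM`) for block-upper-triangular `Z` and a frame as above. [cite: Kudla1994, §3] [cite: HarrisKudlaSweet1996, §1 (1.12)] -/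
theorem detDeltaM_conj_of_frame (S Si Z : Matrix (Fin (n + n)) (Fin (n + n)) R) (X Y : Matrix (Fin n) (Fin n) R) (a : R) (ha : a + a = 1)
    (hS : Matrix.reindex (e₂ (n := n)).symm (e₂ (n := n)).symm S = Matrix.fromBlocks 1 X 1 (-X))
    (hSi : Matrix.reindex (e₂ (n := n)).symm (e₂ (n := n)).symm Si = Matrix.fromBlocks (a • (1 : Matrix (Fin n) (Fin n) R)) (a • 1) Y (-Y))
    (hZ : Z.BlockTriangular id) :
    detDeltaM (S * Z * Si) = ((Matrix.reindex (e₂ (n := n)).symm (e₂ (n := n)).symm Z).toBlocks₁₁).det := by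
  obtain ⟨h1, -⟩ := rowBlocks_conj_of_frame S Si Z X Y a ha hS hSi hZ
  unfold detDeltaM
  rw [h1]

/-- block-upper-triangularity is preserved by entrywise ring maps. [folklore] -/
theorem blockTriangular_map {R' : Type*} [CommRing R'] {m : ℕ} {M : Matrix (Fin m) (Fin m) R} (f : R →+* R') (h : M.BlockTriangular id) :
    (M.map f).BlockTriangular id := fun i j hij => by
  rw [Matrix.map_apply, h hij, map_zero]

end Generic

/-! ## §2 At the place `v`: `Ψ_v(ξ m(1,b) ξ⁻¹) ∈ P_Δ(L⁺_v)`, its `det_Δ`, its Siegel character; `Ψ_v(ξ u₊ ξ⁻¹)` is invisible -/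

section Place

variable (L : Type) [Field L] [NumberField L] [IsCMField L]
variable {N M : ℕ} (e : Fin N × Fin M ≃ Fin 2)
  (dV : Fin N → L) (hdV : ∀ i, IsCMField.complexConj L (dV i) = dV i)
  (dW : Fin M → L) (hdW : ∀ i, IsCMField.complexConj L (dW i) = dW i)
  (v : HeightOneSpectrum (𝓞 (Fp L)))
  (Ψv : UnitaryGroup.localPi L (IsCMField.complexConj L) 4 ((StdForm.antidiagonal 4).over L) v →*
    UnitaryGroup.localPi L (IsCMField.complexConj L) (2 + 2) (hermD L e dV hdV dW hdW) v)
  (SAw : ∀ w : UnitaryGroup.PlacesOver L v, GL (Fin 4) (w.1.adicCompletion L))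
  (Xw Yw : ∀ w : UnitaryGroup.PlacesOver L v, Matrix (Fin 2) (Fin 2) (w.1.adicCompletion L))
  (aw : ∀ w : UnitaryGroup.PlacesOver L v, w.1.adicCompletion L)
  (haw : ∀ w, aw w + aw w = 1)
  (hSAw : ∀ w, Matrix.reindex (e₂ (n := 2)).symm (e₂ (n := 2)).symm ((SAw w : GL (Fin 4) (w.1.adicCompletion L)) : Matrix (Fin 4) (Fin 4) (w.1.adicCompletion L)) =
    Matrix.fromBlocks 1 (Xw w) 1 (-(Xw w)))
  (hSAwi : ∀ w, Matrix.reindex (e₂ (n := 2)).symm (e₂ (n := 2)).symm (((SAw w)⁻¹ : GL (Fin 4) (w.1.adicCompletion L)) : Matrix (Fin 4) (Fin 4) (w.1.adicCompletion L)) =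
    Matrix.fromBlocks (aw w • (1 : Matrix (Fin 2) (Fin 2) (w.1.adicCompletion L))) (aw w • 1) (Yw w) (-(Yw w)))
  (hΨv : ∀ (z : UnitaryGroup.localPi L (IsCMField.complexConj L) 4 ((StdForm.antidiagonal 4).over L) v) (w : UnitaryGroup.PlacesOver L v),
    (((Ψv z : UnitaryGroup.localPi L (IsCMField.complexConj L) (2 + 2) (hermD L e dV hdV dW hdW) v) : UnitaryGroup.LocalGLPi L (2 + 2) v) w :
        Matrix (Fin (2 + 2)) (Fin (2 + 2)) (w.1.adicCompletion L)) =
      ((SAw w : GL (Fin 4) (w.1.adicCompletion L)) : Matrix (Fin 4) (Fin 4) (w.1.adicCompletion L)) *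
        (((z : UnitaryGroup.LocalGLPi L 4 v) w : GL (Fin 4) (w.1.adicCompletion L)) : Matrix (Fin 4) (Fin 4) (w.1.adicCompletion L)) *
        (((SAw w)⁻¹ : GL (Fin 4) (w.1.adicCompletion L)) : Matrix (Fin 4) (Fin 4) (w.1.adicCompletion L)))

/-- the `w`-matrix of `j_v g` is the `w`-evaluation of the matrix of `g ∈ U(J₄)(L_v, c ⊗ 1)` (★ B `coe_jLoc_apply`). [cite: PlatonovRapinchuk1994, §5.1] -/
theorem coe_jLoc_eq_map (g : unitaryGroupOfForm (conjLocal L (IsCMField.complexConj L) v) ((StdForm.antidiagonal 4).over (UnitaryGroup.LocalRing L v)))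
    (w : UnitaryGroup.PlacesOver L v) :
    (((jLoc L 4 v g : UnitaryGroup.localPi L (IsCMField.complexConj L) 4 ((StdForm.antidiagonal 4).over L) v) : UnitaryGroup.LocalGLPi L 4 v) w :
        Matrix (Fin 4) (Fin 4) (w.1.adicCompletion L)) =
      ((g : GL (Fin 4) (UnitaryGroup.LocalRing L v)) : Matrix (Fin 4) (Fin 4) (UnitaryGroup.LocalRing L v)).map
        (Pi.evalRingHom (fun w : UnitaryGroup.PlacesOver L v => w.1.adicCompletion L) w) :=
  Matrix.ext fun i j => coe_jLoc_apply L 4 v g w i j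

include hΨv in
/-- **the `w`-matrix of `Ψ_v(j_v g)` is `S_w · g_w · S_w⁻¹`** (`hΨv` + `coe_jLoc_eq_map`). [cite: BorelJacquet1979, §4.1] [cite: PlatonovRapinchuk1994, §5.1] -/
theorem coe_psiv_jLoc (g : unitaryGroupOfForm (conjLocal L (IsCMField.complexConj L) v) ((StdForm.antidiagonal 4).over (UnitaryGroup.LocalRing L v)))
    (w : UnitaryGroup.PlacesOver L v) :
    (((Ψv (jLoc L 4 v g) : UnitaryGroup.localPi L (IsCMField.complexConj L) (2 + 2) (hermD L e dV hdV dW hdW) v) : UnitaryGroup.LocalGLPi L (2 + 2) v) w :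
        Matrix (Fin (2 + 2)) (Fin (2 + 2)) (w.1.adicCompletion L)) =
      ((SAw w : GL (Fin 4) (w.1.adicCompletion L)) : Matrix (Fin 4) (Fin 4) (w.1.adicCompletion L)) *
        ((g : GL (Fin 4) (UnitaryGroup.LocalRing L v)) : Matrix (Fin 4) (Fin 4) (UnitaryGroup.LocalRing L v)).map
          (Pi.evalRingHom (fun w : UnitaryGroup.PlacesOver L v => w.1.adicCompletion L) w) *
        (((SAw w)⁻¹ : GL (Fin 4) (w.1.adicCompletion L)) : Matrix (Fin 4) (Fin 4) (w.1.adicCompletion L)) := by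
  rw [hΨv, coe_jLoc_eq_map]

/-- an upper-triangular `b ∈ U(J₂)(L⁺_v)` read in `U(J₂)(L_v, c ⊗ 1)` has zero corner (★ B `coe_jLoc_symm_apply`, componentwise). [folklore] -/
theorem jLoc_symm_apply_one_zero (b : UnitaryGroup.localPi L (IsCMField.complexConj L) 2 ((StdForm.antidiagonal 2).over L) v)
    (hb : ∀ w : UnitaryGroup.PlacesOver L v,
      (((b : UnitaryGroup.LocalGLPi L 2 v) w : GL (Fin 2) (w.1.adicCompletion L)) : Matrix (Fin 2) (Fin 2) (w.1.adicCompletion L)) 1 0 = 0) :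
    ((((jLoc L 2 v).symm b : unitaryGroupOfForm (conjLocal L (IsCMField.complexConj L) v) ((StdForm.antidiagonal 2).over (UnitaryGroup.LocalRing L v))) :
        GL (Fin 2) (UnitaryGroup.LocalRing L v)) : Matrix (Fin 2) (Fin 2) (UnitaryGroup.LocalRing L v)) 1 0 = 0 :=
  funext fun w => by rw [Pi.zero_apply, ← hb w]; exact coe_jLoc_symm_apply L 2 v b w 1 0

include haw hSAw hSAwi hΨv in
/-- **a block-upper-triangular `g ∈ U(J₄)(L_v)` goes to `P_Δ(L⁺_v)` under `Ψ_v ∘ j_v`, with `det_Δ,w = (det g₁₁)_w`** (§1 at `R := L_w`, `coe_psiv_jLoc`,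
★ `toBlocks_reindex_e₂_map`, `RingHom.map_det`). [cite: Kudla1994, §3] [cite: HarrisKudlaSweet1996, §1 (1.11)–(1.12)] -/
theorem psiv_jLoc_mem_and_det (g : unitaryGroupOfForm (conjLocal L (IsCMField.complexConj L) v) ((StdForm.antidiagonal 4).over (UnitaryGroup.LocalRing L v)))
    (hg : ((g : GL (Fin 4) (UnitaryGroup.LocalRing L v)) : Matrix (Fin 4) (Fin 4) (UnitaryGroup.LocalRing L v)).BlockTriangular id) :
    Ψv (jLoc L 4 v g) ∈ siegelDeltaLoc L e dV hdV dW hdW v ∧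
      ∀ w : UnitaryGroup.PlacesOver L v,
        LocalSplitting.detDelta (Fp L) L (IsCMField.complexConj L) v 2 w (Ψv (jLoc L 4 v g)) =
          (Pi.evalRingHom (fun w : UnitaryGroup.PlacesOver L v => w.1.adicCompletion L) w)
            ((Matrix.reindex (e₂ (n := 2)).symm (e₂ (n := 2)).symm
              ((g : GL (Fin 4) (UnitaryGroup.LocalRing L v)) : Matrix (Fin 4) (Fin 4) (UnitaryGroup.LocalRing L v))).toBlocks₁₁).det := by
  have hZ : ∀ w : UnitaryGroup.PlacesOver L v,
      (((g : GL (Fin 4) (UnitaryGroup.LocalRing L v)) : Matrix (Fin 4) (Fin 4) (UnitaryGroup.LocalRing L v)).map (Pi.evalRingHom (fun w : UnitaryGroup.PlacesOver L v => w.1.adicCompletion L) w)).BlockTriangular id :=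
    fun w => blockTriangular_map _ hg
  refine ⟨(mem_siegelDeltaLoc_iff_isSiegelM L e dV hdV dW hdW v _).2 fun w => ?_, fun w => ?_⟩
  · rw [coe_psiv_jLoc L e dV hdV dW hdW v Ψv SAw hΨv g w]
    exact isSiegelM_conj_of_frame _ _ _ (Xw w) (Yw w) (aw w) (haw w) (hSAw w) (hSAwi w) (hZ w)
  · rw [localDetDelta_eq_detDeltaM L e dV hdV dW hdW v w, coe_psiv_jLoc L e dV hdV dW hdW v Ψv SAw hΨv g w,
      detDeltaM_conj_of_frame _ _ _ (Xw w) (Yw w) (aw w) (haw w) (hSAw w) (hSAwi w) (hZ w),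
      (toBlocks_reindex_e₂_map (n := 2) (Pi.evalRingHom (fun w : UnitaryGroup.PlacesOver L v => w.1.adicCompletion L) w) _).1, ← RingHom.mapMatrix_apply, ← RingHom.map_det]

include haw hSAw hSAwi hΨv in
/-- **`Ψ_v(ξ_v · m_{Q,v}(1, b) · ξ_v⁻¹) ∈ P_Δ(L⁺_v)` and `det_Δ,w = (b_w)₀₀`** for upper-triangular `b ∈ U(J₂)(L⁺_v)` — place-`v` twin of ★ F5-c
`isSiegelDelta_transport_weylXi_conj_klingenLevi` ∕ `detDelta_transport_weylXi_conj_klingenLevi` (`a := 1`): ★ F5-c's generic-ring matrix of `ξ m_Q(1,b) ξ⁻¹` over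
`L_v = Π_w L_w` read at `w`. [cite: Xiong2013, §4 Prop. 4.1] [cite: GanTakeda2011SiegelWeil, §7.2 p. 23] [cite: Kudla1994, §3] -/
theorem psiv_weylXi_conj_klingenLevi_mem_and_det (b : UnitaryGroup.localPi L (IsCMField.complexConj L) 2 ((StdForm.antidiagonal 2).over L) v)
    (hb : ∀ w : UnitaryGroup.PlacesOver L v,
      (((b : UnitaryGroup.LocalGLPi L 2 v) w : GL (Fin 2) (w.1.adicCompletion L)) : Matrix (Fin 2) (Fin 2) (w.1.adicCompletion L)) 1 0 = 0) :
    Ψv (jLoc L 4 v (weylXi (UnitaryGroup.LocalRing L v) (conjLocal L (IsCMField.complexConj L) v) *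
          klingenLevi (UnitaryGroup.LocalRing L v) (conjLocal L (IsCMField.complexConj L) v) (conjLocal_conjLocal_cm L v) 1 ((jLoc L 2 v).symm b) *
          (weylXi (UnitaryGroup.LocalRing L v) (conjLocal L (IsCMField.complexConj L) v))⁻¹)) ∈ siegelDeltaLoc L e dV hdV dW hdW v ∧
      ∀ w : UnitaryGroup.PlacesOver L v,
        LocalSplitting.detDelta (Fp L) L (IsCMField.complexConj L) v 2 w (Ψv (jLoc L 4 v (weylXi (UnitaryGroup.LocalRing L v) (conjLocal L (IsCMField.complexConj L) v) *
          klingenLevi (UnitaryGroup.LocalRing L v) (conjLocal L (IsCMField.complexConj L) v) (conjLocal_conjLocal_cm L v) 1 ((jLoc L 2 v).symm b) *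
          (weylXi (UnitaryGroup.LocalRing L v) (conjLocal L (IsCMField.complexConj L) v))⁻¹))) =
          (((b : UnitaryGroup.LocalGLPi L 2 v) w : GL (Fin 2) (w.1.adicCompletion L)) : Matrix (Fin 2) (Fin 2) (w.1.adicCompletion L)) 0 0 := by
  have hb' := jLoc_symm_apply_one_zero L v b hb
  obtain ⟨hmem, hdet⟩ := psiv_jLoc_mem_and_det L e dV hdV dW hdW v Ψv SAw Xw Yw aw haw hSAw hSAwi hΨv _
    (blockTriangular_weylXi_conj_klingenLevi_of_upper (conjLocal_conjLocal_cm L v) 1 hb')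
  refine ⟨hmem, fun w => ?_⟩
  rw [hdet w, det_toBlocks₁₁_weylXi_conj_klingenLevi_of_upper (conjLocal_conjLocal_cm L v) 1 hb', inv_one, Units.val_one, map_one, mul_one]
  exact coe_jLoc_symm_apply L 2 v b w 0 0

/-- **the Siegel character from the local `det_Δ`'s**: if `p ∈ P_Δ(L⁺_v)` has `det_Δ,w(p) = u_w ∈ L_wˣ` at every `w ∣ v`, then
`siegelCharLoc χ v s p = ∏_{w∣v} χ_w(u_w) · (∏_{w∣v} ‖u_w‖_w)^{s+1}` (★ D7c `siegelCharLoc_eq_localSiegelCharacter_of_mem`, ★ D1 `localSiegelCharacter` at `n = 2`).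
[cite: HarrisKudlaSweet1996, §1 (1.15)] -/
theorem siegelCharLoc_eq_of_localDetDelta (χ : HeckeCharacter L) (s : ℂ) (p : UnitaryGroup.localPi L (IsCMField.complexConj L) (2 + 2) (hermD L e dV hdV dW hdW) v) (hmem : p ∈ siegelDeltaLoc L e dV hdV dW hdW v)
    (u : ∀ w : UnitaryGroup.PlacesOver L v, (w.1.adicCompletion L)ˣ)
    (hdet : ∀ w : UnitaryGroup.PlacesOver L v, LocalSplitting.detDelta (Fp L) L (IsCMField.complexConj L) v 2 w p = (u w : w.1.adicCompletion L)) :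
    siegelCharLoc L e dV hdV dW hdW v χ s p =
      (∏ w : UnitaryGroup.PlacesOver L v, ((χ.localComponent w.1 (u w) : ℂˣ) : ℂ)) *
        (((∏ w : UnitaryGroup.PlacesOver L v, ‖(u w : w.1.adicCompletion L)‖ : ℝ) : ℂ) ^ (s + 1)) := by
  haveI : Algebra.IsQuadraticExtension (Fp L) L := IsCMField.isQuadraticExtension L
  have hunit : ∀ w : UnitaryGroup.PlacesOver L v, IsUnit (LocalSplitting.detDelta (Fp L) L (IsCMField.complexConj L) v 2 w p) :=
    fun w => (hdet w) ▸ (u w).isUnit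
  have hunit' : ∀ w : UnitaryGroup.PlacesOver L v, (hunit w).unit = u w := fun w => Units.ext (by rw [IsUnit.unit_spec, hdet])
  have hchi : ((LocalSplitting.chiDet (Fp L) L (IsCMField.complexConj L) v 2 (fun w => χ.localComponent w.1) p : ℂˣ) : ℂ) =
      ∏ w : UnitaryGroup.PlacesOver L v, ((χ.localComponent w.1 (u w) : ℂˣ) : ℂ) := by
    rw [LocalSplitting.chiDet, Units.coe_prod]
    exact Finset.prod_congr rfl fun w _ => by rw [dif_pos (hunit w), hunit' w]
  have habs : absDetDelta (Fp L) L (IsCMField.complexConj L) v 2 p = ∏ w : UnitaryGroup.PlacesOver L v, ‖(u w : w.1.adicCompletion L)‖ := by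
    simp only [absDetDelta, hdet]
  have htwo : (s + ((2 : ℕ) : ℂ) / 2) = s + 1 := by push_cast; ring
  rw [siegelCharLoc_eq_localSiegelCharacter_of_mem L e dV hdV dW hdW v χ s hmem, localSiegelCharacter, hchi, habs, htwo]

/-- **… and `siegelCharLoc χ v s p = 1` when every `det_Δ,w(p) = 1`** (block-unipotent elements). [cite: HarrisKudlaSweet1996, §1 (1.15)] -/
theorem siegelCharLoc_eq_one_of_localDetDelta_eq_one (χ : HeckeCharacter L) (s : ℂ) (p : UnitaryGroup.localPi L (IsCMField.complexConj L) (2 + 2) (hermD L e dV hdV dW hdW) v) (hmem : p ∈ siegelDeltaLoc L e dV hdV dW hdW v)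
    (hdet : ∀ w : UnitaryGroup.PlacesOver L v, LocalSplitting.detDelta (Fp L) L (IsCMField.complexConj L) v 2 w p = 1) :
    siegelCharLoc L e dV hdV dW hdW v χ s p = 1 := by
  have h := siegelCharLoc_eq_of_localDetDelta L e dV hdV dW hdW v χ s p hmem (fun _ => 1) (fun w => by rw [hdet w, Units.val_one])
  rw [h]
  simp only [map_one, Units.val_one, Finset.prod_const_one, norm_one, Complex.ofReal_one, Complex.one_cpow, mul_one]

include haw hSAw hSAwi hΨv in
/-- **THE VALUE `cΔ(b)`**: for upper-triangular `b ∈ U(J₂)(L⁺_v)` with corner units `u_w = (b_w)₀₀`,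
`siegelCharLoc χ v s (Ψ_v(ξ_v m_{Q,v}(1,b) ξ_v⁻¹)) = ∏_{w∣v} χ_w(u_w) · (∏_{w∣v} ‖u_w‖_w)^{s+1}` — the inducing character `χ_v(det_Δ)|det_Δ|_v^{s + n/2}` of `I_v(s, χ_v)`
(`n = 2`) of the doubled `U(2,2)` read on the Klingen Levi. [cite: Xiong2013, §4 Prop. 4.1] [cite: HarrisKudlaSweet1996, §1 (1.15)] [cite: MoeglinWaldspurger1995, II.1.7] -/
theorem siegelCharLoc_psiv_weylXi_conj_klingenLevi (χ : HeckeCharacter L) (s : ℂ)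
    (b : UnitaryGroup.localPi L (IsCMField.complexConj L) 2 ((StdForm.antidiagonal 2).over L) v)
    (u : ∀ w : UnitaryGroup.PlacesOver L v, (w.1.adicCompletion L)ˣ)
    (hb : ∀ w : UnitaryGroup.PlacesOver L v,
      (((b : UnitaryGroup.LocalGLPi L 2 v) w : GL (Fin 2) (w.1.adicCompletion L)) : Matrix (Fin 2) (Fin 2) (w.1.adicCompletion L)) 1 0 = 0)
    (hu : ∀ w : UnitaryGroup.PlacesOver L v, (u w : w.1.adicCompletion L) =
      (((b : UnitaryGroup.LocalGLPi L 2 v) w : GL (Fin 2) (w.1.adicCompletion L)) : Matrix (Fin 2) (Fin 2) (w.1.adicCompletion L)) 0 0) :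
    siegelCharLoc L e dV hdV dW hdW v χ s (Ψv (jLoc L 4 v (weylXi (UnitaryGroup.LocalRing L v) (conjLocal L (IsCMField.complexConj L) v) *
          klingenLevi (UnitaryGroup.LocalRing L v) (conjLocal L (IsCMField.complexConj L) v) (conjLocal_conjLocal_cm L v) 1 ((jLoc L 2 v).symm b) *
          (weylXi (UnitaryGroup.LocalRing L v) (conjLocal L (IsCMField.complexConj L) v))⁻¹))) =
      (∏ w : UnitaryGroup.PlacesOver L v, ((χ.localComponent w.1 (u w) : ℂˣ) : ℂ)) *
        (((∏ w : UnitaryGroup.PlacesOver L v, ‖(u w : w.1.adicCompletion L)‖ : ℝ) : ℂ) ^ (s + 1)) := by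
  obtain ⟨hmem, hdet⟩ := psiv_weylXi_conj_klingenLevi_mem_and_det L e dV hdV dW hdW v Ψv SAw Xw Yw aw haw hSAw hSAwi hΨv b hb
  exact siegelCharLoc_eq_of_localDetDelta L e dV hdV dW hdW v χ s _ hmem u fun w => by rw [hdet w, hu w]

include haw hSAw hSAwi hΨv in
/-- **`Ψ_v(ξ_v · u₊(t) · ξ_v⁻¹)` IS INVISIBLE TO SIEGEL SECTIONS**: it lies in `P_Δ(L⁺_v)` with Siegel character `1` (★ `weylXi_mul_uPlus_mul_inv`: `ξ u₊(t) ξ⁻¹ = u₋(−σt)`, block-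
unipotent ★ `uMinusM_blockTriangular`, `det_toBlocks₁₁_uMinusM`). [cite: GanTakeda2011SiegelWeil, §7.2 p. 23] [cite: HarrisKudlaSweet1996, §1 (1.15)] -/
theorem psiv_weylXi_conj_uPlus_mem_and_siegelCharLoc (χ : HeckeCharacter L) (s : ℂ) (t : UnitaryGroup.LocalRing L v) :
    Ψv (jLoc L 4 v (weylXi (UnitaryGroup.LocalRing L v) (conjLocal L (IsCMField.complexConj L) v) *
          uPlus (UnitaryGroup.LocalRing L v) (conjLocal L (IsCMField.complexConj L) v) (conjLocal_conjLocal_cm L v) t *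
          (weylXi (UnitaryGroup.LocalRing L v) (conjLocal L (IsCMField.complexConj L) v))⁻¹)) ∈ siegelDeltaLoc L e dV hdV dW hdW v ∧
      siegelCharLoc L e dV hdV dW hdW v χ s (Ψv (jLoc L 4 v (weylXi (UnitaryGroup.LocalRing L v) (conjLocal L (IsCMField.complexConj L) v) *
          uPlus (UnitaryGroup.LocalRing L v) (conjLocal L (IsCMField.complexConj L) v) (conjLocal_conjLocal_cm L v) t *
          (weylXi (UnitaryGroup.LocalRing L v) (conjLocal L (IsCMField.complexConj L) v))⁻¹))) = 1 := by
  rw [weylXi_mul_uPlus_mul_inv (conjLocal_conjLocal_cm L v) t]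
  obtain ⟨hmem, hdet⟩ := psiv_jLoc_mem_and_det L e dV hdV dW hdW v Ψv SAw Xw Yw aw haw hSAw hSAwi hΨv
    (uMinus (UnitaryGroup.LocalRing L v) (conjLocal L (IsCMField.complexConj L) v) (conjLocal_conjLocal_cm L v)
      (-(conjLocal L (IsCMField.complexConj L) v t))) (by rw [coe_uMinus]; exact uMinusM_blockTriangular _)
  exact ⟨hmem, siegelCharLoc_eq_one_of_localDetDelta_eq_one L e dV hdV dW hdW v χ s _ hmem fun w => by
    rw [hdet w, coe_uMinus, det_toBlocks₁₁_uMinusM, map_one]⟩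

/-! ## §3 The dischargers of `hfP` and `hfU` for `f_v = Λ_{s,v}` -/

include haw hSAw hSAwi hΨv in
/-- **`hfP` FOR THE UNRAMIFIED SECTION**: `Λ_{s,v}(Ψ_v(ξ m(1,b) ξ⁻¹) · h) = cΔ(b) · Λ_{s,v}(h)` with `cΔ(b) := siegelCharLoc χ v s (Ψ_v(ξ m(1,b) ξ⁻¹))` (★ D7c
`lambdaLoc_siegel_mul` + §2 membership), `χ` unramified above `v`; the VALUE of `cΔ(b)` is `siegelCharLoc_psiv_weylXi_conj_klingenLevi`. [cite: MoeglinWaldspurger1995, II.1.7]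
[cite: HarrisKudlaSweet1996, §1 (1.15)] -/
theorem lambdaLoc_psiv_levi_mul (χ : HeckeCharacter L) (s : ℂ) (hχ : ∀ w : UnitaryGroup.PlacesOver L v, χ.IsUnramifiedAt w.1)
    (b : UnitaryGroup.localPi L (IsCMField.complexConj L) 2 ((StdForm.antidiagonal 2).over L) v)
    (hb : ∀ w : UnitaryGroup.PlacesOver L v,
      (((b : UnitaryGroup.LocalGLPi L 2 v) w : GL (Fin 2) (w.1.adicCompletion L)) : Matrix (Fin 2) (Fin 2) (w.1.adicCompletion L)) 1 0 = 0)
    (h : UnitaryGroup.localPi L (IsCMField.complexConj L) (2 + 2) (hermD L e dV hdV dW hdW) v) :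
    LambdaLoc L e dV hdV dW hdW v χ s
        (Ψv (jLoc L 4 v (weylXi (UnitaryGroup.LocalRing L v) (conjLocal L (IsCMField.complexConj L) v) *
          klingenLevi (UnitaryGroup.LocalRing L v) (conjLocal L (IsCMField.complexConj L) v) (conjLocal_conjLocal_cm L v) 1 ((jLoc L 2 v).symm b) *
          (weylXi (UnitaryGroup.LocalRing L v) (conjLocal L (IsCMField.complexConj L) v))⁻¹)) * h) =
      siegelCharLoc L e dV hdV dW hdW v χ s
          (Ψv (jLoc L 4 v (weylXi (UnitaryGroup.LocalRing L v) (conjLocal L (IsCMField.complexConj L) v) *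
            klingenLevi (UnitaryGroup.LocalRing L v) (conjLocal L (IsCMField.complexConj L) v) (conjLocal_conjLocal_cm L v) 1 ((jLoc L 2 v).symm b) *
            (weylXi (UnitaryGroup.LocalRing L v) (conjLocal L (IsCMField.complexConj L) v))⁻¹))) *
        LambdaLoc L e dV hdV dW hdW v χ s h :=
  lambdaLoc_siegel_mul L e dV hdV dW hdW v χ s hχ (psiv_weylXi_conj_klingenLevi_mem_and_det L e dV hdV dW hdW v Ψv SAw Xw Yw aw haw hSAw hSAwi hΨv b hb).1 h

include haw hSAw hSAwi hΨv in
/-- **`hfU` FOR THE UNRAMIFIED SECTION**: `Λ_{s,v}(Ψ_v(ξ u₊(t) ξ⁻¹) · h) = Λ_{s,v}(h)` (§2: member with character `1`). [cite: MoeglinWaldspurger1995, II.1.7] -/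
theorem lambdaLoc_psiv_uPlus_mul (χ : HeckeCharacter L) (s : ℂ) (hχ : ∀ w : UnitaryGroup.PlacesOver L v, χ.IsUnramifiedAt w.1) (t : UnitaryGroup.LocalRing L v)
    (h : UnitaryGroup.localPi L (IsCMField.complexConj L) (2 + 2) (hermD L e dV hdV dW hdW) v) :
    LambdaLoc L e dV hdV dW hdW v χ s
        (Ψv (jLoc L 4 v (weylXi (UnitaryGroup.LocalRing L v) (conjLocal L (IsCMField.complexConj L) v) *
          uPlus (UnitaryGroup.LocalRing L v) (conjLocal L (IsCMField.complexConj L) v) (conjLocal_conjLocal_cm L v) t *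
          (weylXi (UnitaryGroup.LocalRing L v) (conjLocal L (IsCMField.complexConj L) v))⁻¹)) * h) =
      LambdaLoc L e dV hdV dW hdW v χ s h := by
  obtain ⟨hmem, hone⟩ := psiv_weylXi_conj_uPlus_mem_and_siegelCharLoc L e dV hdV dW hdW v Ψv SAw Xw Yw aw haw hSAw hSAwi hΨv χ s t
  rw [lambdaLoc_siegel_mul L e dV hdV dW hdW v χ s hχ hmem h, hone, one_mul]

end Place

/-! ## §4 The assembly into ★ C's `hlaw` at `σ = s − ½` -/

section Assembly

variable (L : Type) [Field L] [NumberField L] [IsCMField L] (v : HeightOneSpectrum (𝓞 (Fp L)))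

omit [IsCMField L] in
/-- the product of the local absolute values of a family of units is positive. [folklore] -/
theorem prod_norm_units_pos (u : ∀ w : UnitaryGroup.PlacesOver L v, (w.1.adicCompletion L)ˣ) :
    0 < ∏ w : UnitaryGroup.PlacesOver L v, ‖(u w : w.1.adicCompletion L)‖ :=
  Finset.prod_pos fun w _ => norm_pos_iff.2 (u w).ne_zero

/-- **ASSEMBLY INTO ★ C's `hlaw`.**  Let `J : U(J₂)(L⁺_v) → ℂ` satisfy p09's Levi law `J(b g) = cΔ(b) · (mT u).toReal · J(g)` for upper-triangular `b` with product-ring corner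
unit `u` (`hJ`, BY VALUE), let `cΔ(b) = ∏_w χ_w(u_w) · (∏_w ‖u_w‖_w)^{s+1}` for every family of corner units (`hcΔ` — §2 `siegelCharLoc_psiv_weylXi_conj_klingenLevi`) and
`(mT u).toReal = (∏_w ‖u_w‖_w)⁻¹` (`hmT` — the local Haar modulus).  THEN `J` has ★ C's local Borel law in entries at the parameter `σ := s − ½`:
`J(b g) = ∏_w χ_w(u_w) · (∏_w ‖u_w‖_w)^{(s − ½) + ½} · J(g)` — VERBATIM the binder `hlaw` of ★ `K2LiuKlingenInnerSectionSpherical` §4. [cite: MoeglinWaldspurger1995, II.1.7] [cite: Tan1999, §2] -/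
theorem hlaw_of_upper_mul (χ : HeckeCharacter L) (s : ℂ)
    {Jv : UnitaryGroup.localPi L (IsCMField.complexConj L) 2 ((StdForm.antidiagonal 2).over L) v → ℂ}
    {cΔ : UnitaryGroup.localPi L (IsCMField.complexConj L) 2 ((StdForm.antidiagonal 2).over L) v → ℂ} {mT : (UnitaryGroup.LocalRing L v)ˣ → ENNReal}
    (hJ : ∀ (b g : UnitaryGroup.localPi L (IsCMField.complexConj L) 2 ((StdForm.antidiagonal 2).over L) v) (U : (UnitaryGroup.LocalRing L v)ˣ),
      (∀ w : UnitaryGroup.PlacesOver L v,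
        (((b : UnitaryGroup.LocalGLPi L 2 v) w : GL (Fin 2) (w.1.adicCompletion L)) : Matrix (Fin 2) (Fin 2) (w.1.adicCompletion L)) 1 0 = 0) →
      (∀ w : UnitaryGroup.PlacesOver L v, (U : UnitaryGroup.LocalRing L v) w =
        (((b : UnitaryGroup.LocalGLPi L 2 v) w : GL (Fin 2) (w.1.adicCompletion L)) : Matrix (Fin 2) (Fin 2) (w.1.adicCompletion L)) 0 0) →
        Jv (b * g) = cΔ b * ((mT U).toReal : ℂ) * Jv g)
    (hcΔ : ∀ (b : UnitaryGroup.localPi L (IsCMField.complexConj L) 2 ((StdForm.antidiagonal 2).over L) v) (u : ∀ w : UnitaryGroup.PlacesOver L v, (w.1.adicCompletion L)ˣ),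
      (∀ w : UnitaryGroup.PlacesOver L v,
        (((b : UnitaryGroup.LocalGLPi L 2 v) w : GL (Fin 2) (w.1.adicCompletion L)) : Matrix (Fin 2) (Fin 2) (w.1.adicCompletion L)) 1 0 = 0) →
      (∀ w : UnitaryGroup.PlacesOver L v, (u w : w.1.adicCompletion L) =
        (((b : UnitaryGroup.LocalGLPi L 2 v) w : GL (Fin 2) (w.1.adicCompletion L)) : Matrix (Fin 2) (Fin 2) (w.1.adicCompletion L)) 0 0) →
        cΔ b = (∏ w : UnitaryGroup.PlacesOver L v, ((χ.localComponent w.1 (u w) : ℂˣ) : ℂ)) *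
          (((∏ w : UnitaryGroup.PlacesOver L v, ‖(u w : w.1.adicCompletion L)‖ : ℝ) : ℂ) ^ (s + 1)))
    (hmT : ∀ U : (UnitaryGroup.LocalRing L v)ˣ, (mT U).toReal = (∏ w : UnitaryGroup.PlacesOver L v, ‖(U : UnitaryGroup.LocalRing L v) w‖)⁻¹)
    (b g : UnitaryGroup.localPi L (IsCMField.complexConj L) 2 ((StdForm.antidiagonal 2).over L) v) (u : ∀ w : UnitaryGroup.PlacesOver L v, (w.1.adicCompletion L)ˣ)
    (hb : ∀ w : UnitaryGroup.PlacesOver L v,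
      (((b : UnitaryGroup.LocalGLPi L 2 v) w : GL (Fin 2) (w.1.adicCompletion L)) : Matrix (Fin 2) (Fin 2) (w.1.adicCompletion L)) 1 0 = 0)
    (hu : ∀ w : UnitaryGroup.PlacesOver L v, (u w : w.1.adicCompletion L) =
      (((b : UnitaryGroup.LocalGLPi L 2 v) w : GL (Fin 2) (w.1.adicCompletion L)) : Matrix (Fin 2) (Fin 2) (w.1.adicCompletion L)) 0 0) :
    Jv (b * g) = (∏ w : UnitaryGroup.PlacesOver L v, ((χ.localComponent w.1 (u w) : ℂˣ) : ℂ)) *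
      (((∏ w : UnitaryGroup.PlacesOver L v, ‖(u w : w.1.adicCompletion L)‖ : ℝ) : ℂ) ^ (s - 1 / 2 + 1 / 2)) * Jv g := by
  -- the product-ring unit with components `u_w`
  let U : (UnitaryGroup.LocalRing L v)ˣ :=
    ⟨fun w => (u w : w.1.adicCompletion L), fun w => ((u w)⁻¹ : (w.1.adicCompletion L)ˣ),
      funext fun w => by simp only [Pi.mul_apply, Pi.one_apply, Units.mul_inv], funext fun w => by simp only [Pi.mul_apply, Pi.one_apply, Units.inv_mul]⟩
  have hU : ∀ w : UnitaryGroup.PlacesOver L v, (U : UnitaryGroup.LocalRing L v) w = (u w : w.1.adicCompletion L) := fun w => rfl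
  set P : ℝ := ∏ w : UnitaryGroup.PlacesOver L v, ‖(u w : w.1.adicCompletion L)‖ with hP
  have hP0 : 0 < P := prod_norm_units_pos L v u
  have hPC : (P : ℂ) ≠ 0 := Complex.ofReal_ne_zero.2 hP0.ne'
  have hmTU : ((mT U).toReal : ℂ) = ((P : ℝ) : ℂ)⁻¹ := by
    rw [hmT U, show (∏ w : UnitaryGroup.PlacesOver L v, ‖(U : UnitaryGroup.LocalRing L v) w‖) = P from Finset.prod_congr rfl fun w _ => by rw [hU w],
      Complex.ofReal_inv]
  rw [hJ b g U hb (fun w => by rw [hU w, hu w]), hcΔ b u hb hu, hmTU, sub_add_cancel, Complex.cpow_add _ _ hPC, Complex.cpow_one]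
  field_simp

end Assembly

end Summit.HodgeConjecture.HodgeConjecture.Cruxes.HLiu418.K2LiuKlingenInnerSectionLocalCharacter

end
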